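import Literature.MathematicalPhysics.StatisticalMechanics.Crystallization
import HarnessLib

/-!
# Local convergence to a periodic point measure from eventual exact matching

Topic: `Literature/MathematicalPhysics/StatisticalMechanics`. A criterion for the convergence
clause of the Blanc–Lewin crystallization statement `IsCrystallizing`
(`Crystallization.lean`; Blanc–Lewin 2015, §2.1 (16)): local (vague) convergence
`∑ᵢ f(yᵢʲ) → ∫ f dμ`, `μ = ∑_{s ∈ F+G} m(s) δ_s`, tested against compactly supported `f`.

## Content

* `PeriodicConfiguration.tsum_mul_eq_sum` — for `f` supported in the ball `B̄(0, R)` the limit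
  functional `∑' s : P.points, m(s) f(s)` is the finite sum over `B̄(0, R) ∩ (F + G)` (a periodic
  configuration is locally finite, `PeriodicConfiguration.finite_inter_points`).
* `PeriodicConfiguration.tendsto_sum_of_eventually_card_eq` — **exact local matching implies
  local convergence**: if for every radius `R`, eventually in `j`, every point `s` of the ball
  `B̄(0, R)` is occupied by exactly `m(s)` particles of the `j`-th configuration when
  `s ∈ F + G` and by none otherwise, then `∑ᵢ f(yᵢʲ) → ∑' s, m(s) f(s)` for every compactly
  supported `f` (continuity is not needed: the sequence is eventually constant). This is the
  form in which exactly solvable models crystallize (sticky potentials, whose finite ground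
  states lie on the limit lattice: Heitmann–Radin 1980 in `d = 2`; the sticky chain in `d = 1`,
  `StickyChainCrystallization.lean`).
* `PeriodicConfiguration.exists_pos_le_dist` — the points of a periodic configuration are
  uniformly separated.
* `PeriodicConfiguration.tendsto_sum_of_eventually_near` (and the primed form in the exact
  shape of `IsCrystallizing`, multiplicity `m ≡ 1`) — **approximate local matching of uniformly
  separated configurations implies local convergence**: if the particles keep a minimal
  distance `δ > 0` and, for every `R` and `ε > 0`, eventually every site of `F + G` in
  `B̄(0, R)` has a particle within `ε` and every particle in `B̄(0, R)` has a site within `ε`,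
  then `∑ᵢ f(yᵢʲ) → ∑' s : F + G, f(s)` for every continuous compactly supported `f` (uniform
  continuity of `f`; for small `ε` the matching is a bijection near the support). This is the
  realistic form (Blanc–Lewin 2015, §2.2: a uniform minimal distance gives multiplicity-free
  locally finite limits), e.g. for assembling `IsCrystallizing lennardJones 3` from a
  defect-vanishing statement plus the minimal-distance bound.

## Sources

* X. Blanc, M. Lewin, *The crystallization conjecture: a review*, EMS Surv. Math. Sci. 2 (2015),
  255–306, arXiv:1504.01153, §2.1 (15)–(17), §2.2 (local weak-∗ convergence of `μ_N(· - τ_N)`).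

-/

noncomputable section

open scoped BigOperators Topology
open Filter Set Metric

namespace Literature.MathematicalPhysics.StatisticalMechanics

variable {d : ℕ}

namespace PeriodicConfiguration

variable (P : PeriodicConfiguration d)

/-- For a test function `f` supported in `B̄(0, R)` and multiplicities `m`, the limit functional
of `IsCrystallizing` is a finite sum: `∑' s : F + G, m(s) f(s) = ∑_{s ∈ T} m(s) f(s)` for any
finite set `T` with `T = B̄(0, R) ∩ (F + G)` (which exists: a periodic configuration is locally
finite). [folklore] -/
theorem tsum_mul_eq_sum {f : EuclideanSpace ℝ (Fin d) → ℝ} {R : ℝ}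
    (hf : tsupport f ⊆ closedBall 0 R) (m : EuclideanSpace ℝ (Fin d) → ℕ)
    {T : Finset (EuclideanSpace ℝ (Fin d))} (hT : ↑T = closedBall 0 R ∩ P.points) :
    ∑' s : P.points, (m s : ℝ) * f s = ∑ s ∈ T, (m s : ℝ) * f s := by
  rw [tsum_subtype (s := P.points) (f := fun s => (m s : ℝ) * f s),
    tsum_eq_sum (f := P.points.indicator fun s => (m s : ℝ) * f s) (s := T)
      (L := SummationFilter.unconditional _) ?_]
  · refine Finset.sum_congr rfl fun s hs => Set.indicator_of_mem ?_ _
    have : s ∈ closedBall 0 R ∩ P.points := by rw [← hT]; exact hs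
    exact this.2
  · intro b hb
    by_cases hbP : b ∈ P.points
    · rw [Set.indicator_of_mem hbP]
      have hbR : b ∉ closedBall (0 : EuclideanSpace ℝ (Fin d)) R := fun h =>
        hb (by rw [← Finset.mem_coe, hT]; exact ⟨h, hbP⟩)
      have : f b = 0 := image_eq_zero_of_notMem_tsupport fun h => hbR (hf h)
      simp [this]
    · exact Set.indicator_of_notMem hbP _

open scoped Classical in
/-- **Exact local matching implies local convergence.** Let `F + G` be a periodic configuration
with multiplicities `m`, and `yʲ = (y₁ʲ, …, y_{n_j}ʲ)` finite configurations. If for every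
`R`, eventually in `j`, each `s` with `‖s‖ ≤ R` satisfies
`#{i : yᵢʲ = s} = m(s)` if `s ∈ F + G` and `= 0` otherwise, then
`∑ᵢ f(yᵢʲ) → ∑' s : F + G, m(s) f(s)` for every compactly supported `f : ℝᵈ → ℝ` — the local
convergence (16) of Blanc–Lewin 2015 towards `μ = ∑ m(s) δ_s`, here by eventual equality.
[folklore] -/
theorem tendsto_sum_of_eventually_card_eq (m : EuclideanSpace ℝ (Fin d) → ℕ) {n : ℕ → ℕ}
    (y : (j : ℕ) → Fin (n j) → EuclideanSpace ℝ (Fin d))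
    (h : ∀ R : ℝ, ∀ᶠ j in atTop, ∀ s : EuclideanSpace ℝ (Fin d), ‖s‖ ≤ R →
      (Finset.univ.filter fun i => y j i = s).card = if s ∈ P.points then m s else 0)
    {f : EuclideanSpace ℝ (Fin d) → ℝ} (hf : HasCompactSupport f) :
    Tendsto (fun j => ∑ i, f (y j i)) atTop (𝓝 (∑' s : P.points, (m s : ℝ) * f s)) := by
  obtain ⟨R, hR⟩ := hf.isCompact.isBounded.subset_closedBall 0
  obtain ⟨T, hT⟩ := (P.finite_inter_points
    (isBounded_closedBall (x := (0 : EuclideanSpace ℝ (Fin d))) (r := R))).exists_finset_coe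
  rw [P.tsum_mul_eq_sum hR m hT]
  refine tendsto_const_nhds.congr' ((h R).mono fun j hj => ?_)
  show ∑ s ∈ T, (m s : ℝ) * f s = ∑ i, f (y j i)
  symm
  -- particles carrying a non-zero value of `f` sit at points of `T`
  have hfT : ∀ i ∈ (Finset.univ : Finset (Fin (n j))), f (y j i) ≠ 0 → y j i ∈ T := by
    intro i _ hi
    have hiR : y j i ∈ closedBall (0 : EuclideanSpace ℝ (Fin d)) R := hR (subset_tsupport _ hi)
    have hcard := hj (y j i) (mem_closedBall_zero_iff.1 hiR)
    have hpos : 0 < (Finset.univ.filter fun i' => y j i' = y j i).card :=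
      Finset.card_pos.2 ⟨i, by simp⟩
    have hiP : y j i ∈ P.points := by
      by_contra hc
      rw [if_neg hc] at hcard
      omega
    rw [← Finset.mem_coe, hT]
    exact ⟨hiR, hiP⟩
  -- sum fibrewise over `T`
  rw [← Finset.sum_filter_of_ne hfT, ← Finset.sum_fiberwise_of_maps_to (t := T) (g := y j)
    (fun i hi => (Finset.mem_filter.1 hi).2)]
  refine Finset.sum_congr rfl fun s hs => ?_
  have hs' : s ∈ closedBall (0 : EuclideanSpace ℝ (Fin d)) R ∩ P.points := by
    rw [← hT]; exact hs
  have hcard := hj s (mem_closedBall_zero_iff.1 hs'.1)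
  rw [if_pos hs'.2] at hcard
  have hfilt : ((Finset.univ.filter fun i => y j i ∈ T).filter fun i => y j i = s) =
      Finset.univ.filter fun i => y j i = s := by
    ext i
    simp only [Finset.mem_filter, Finset.mem_univ, true_and]
    exact ⟨fun h => h.2, fun h => ⟨h ▸ hs, h⟩⟩
  rw [hfilt]
  calc ∑ i ∈ Finset.univ.filter (fun i => y j i = s), f (y j i)
        = ∑ i ∈ Finset.univ.filter (fun i => y j i = s), f s :=
          Finset.sum_congr rfl fun i hi => by rw [(Finset.mem_filter.1 hi).2]
    _ = (m s : ℝ) * f s := by rw [Finset.sum_const, hcard, nsmul_eq_mul]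

/-- **Points of a periodic configuration are uniformly separated**: there is `ρ > 0` with
`dist s s' ≥ ρ` for all distinct `s, s' ∈ F + G` (the lattice is discrete, the motif finite,
and by periodicity it suffices to look around the finitely many motif points). [folklore] -/
theorem exists_pos_le_dist :
    ∃ ρ : ℝ, 0 < ρ ∧ ∀ s ∈ P.points, ∀ s' ∈ P.points, s ≠ s' → ρ ≤ dist s s' := by
  classical
  have hfin : ∀ y : EuclideanSpace ℝ (Fin d), (closedBall y 1 ∩ P.points).Finite := fun y =>
    P.finite_inter_points isBounded_closedBall
  set D : Finset ℝ := P.motif.biUnion fun y => ((hfin y).toFinset.erase y).image (dist y) with hD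
  have hDpos : ∀ r ∈ D, 0 < r := by
    intro r hr
    simp only [hD, Finset.mem_biUnion, Finset.mem_image, Finset.mem_erase] at hr
    obtain ⟨y, -, s', ⟨hs'y, -⟩, rfl⟩ := hr
    exact dist_pos.2 (Ne.symm hs'y)
  refine ⟨if h : D.Nonempty then min 1 (D.min' h) else 1, ?_, ?_⟩
  · split_ifs with h
    · exact lt_min one_pos (hDpos _ (D.min'_mem h))
    · exact one_pos
  · intro s hs s' hs' hne
    have hle1 : (if h : D.Nonempty then min 1 (D.min' h) else 1) ≤ 1 := by
      split_ifs <;> simp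
    obtain ⟨y, hy, g, hg, rfl⟩ := hs
    have hs'g : s' - g ∈ P.points := by
      simpa [sub_eq_add_neg] using P.add_mem_points hs' (P.lattice.neg_mem hg)
    have hdist : dist (y + g) s' = dist y (s' - g) := by
      rw [dist_eq_norm, dist_eq_norm]
      congr 1
      abel
    rw [hdist]
    by_cases h1 : dist y (s' - g) ≤ 1
    · have hne' : s' - g ≠ y := fun h => hne (by rw [← h]; abel)
      have hmem : dist y (s' - g) ∈ D := by
        simp only [hD, Finset.mem_biUnion, Finset.mem_image, Finset.mem_erase,
          Set.Finite.mem_toFinset]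
        exact ⟨y, hy, s' - g, ⟨hne', mem_closedBall'.2 h1, hs'g⟩, rfl⟩
      have hD' : D.Nonempty := ⟨_, hmem⟩
      rw [dif_pos hD']
      exact (min_le_right _ _).trans (D.min'_le _ hmem)
    · linarith [not_le.1 h1]

open scoped Classical in
/-- **Approximate local matching of separated configurations implies local convergence.**
Let `F + G` be a periodic configuration and `yʲ` finite configurations with a uniform minimal
distance `δ > 0`. If for every radius `R` and tolerance `ε > 0`, eventually in `j`, every
site `s ∈ F + G` with `‖s‖ ≤ R` has a particle within `ε` and every particle `yᵢʲ` with
`‖yᵢʲ‖ ≤ R` has a site within `ε`, then `∑ᵢ f(yᵢʲ) → ∑' s : F + G, f(s)` for every continuous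
compactly supported `f` — the local convergence (16) of Blanc–Lewin 2015 to the periodic
measure `μ = ∑_{s ∈ F+G} δ_s` (multiplicity one; cf. §2.2: a uniform minimal distance makes
local limits of the `μ_N(· - τ_N)` multiplicity-free point measures). Proof: for small `ε` the
matching is a bijection near the support of `f`, and `f` is uniformly continuous. [folklore] -/
theorem tendsto_sum_of_eventually_near {n : ℕ → ℕ}
    (y : (j : ℕ) → Fin (n j) → EuclideanSpace ℝ (Fin d))
    {δ : ℝ} (hδ : 0 < δ) (hsep : ∀ j i i', i ≠ i' → δ ≤ dist (y j i) (y j i'))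
    (h : ∀ R ε : ℝ, 0 < ε → ∀ᶠ j in atTop,
        (∀ s ∈ P.points, ‖s‖ ≤ R → ∃ i, dist (y j i) s ≤ ε) ∧
        (∀ i, ‖y j i‖ ≤ R → ∃ s ∈ P.points, dist (y j i) s ≤ ε))
    {f : EuclideanSpace ℝ (Fin d) → ℝ} (hfc : Continuous f) (hf : HasCompactSupport f) :
    Tendsto (fun j => ∑ i, f (y j i)) atTop (𝓝 (∑' s : P.points, f s)) := by
  obtain ⟨R₀, hR₀⟩ := hf.isCompact.isBounded.subset_closedBall 0
  obtain ⟨T, hT⟩ := (P.finite_inter_points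
    (isBounded_closedBall (x := (0 : EuclideanSpace ℝ (Fin d))) (r := R₀ + 1))).exists_finset_coe
  have hL : ∑' s : P.points, f s = ∑ s ∈ T, f s := by
    have := P.tsum_mul_eq_sum (hR₀.trans (closedBall_subset_closedBall (by linarith)))
      (fun _ => 1) hT
    simpa using this
  rw [hL]
  obtain ⟨ρ, hρ, hρsep⟩ := P.exists_pos_le_dist
  have hTmem : ∀ s ∈ T, s ∈ P.points ∧ ‖s‖ ≤ R₀ + 1 := fun s hs => by
    have : s ∈ closedBall (0 : EuclideanSpace ℝ (Fin d)) (R₀ + 1) ∩ P.points := by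
      rw [← hT]; exact hs
    exact ⟨this.2, mem_closedBall_zero_iff.1 this.1⟩
  refine Metric.tendsto_atTop.2 fun η hη => ?_
  -- uniform continuity of `f` at scale `η / (#T + 1)`
  obtain ⟨θ, hθ, hθf⟩ := Metric.uniformContinuous_iff.1 (hf.uniformContinuous_of_continuous hfc)
    (η / (T.card + 1)) (by positivity)
  set ε := min (θ / 2) (min (δ / 3) (min (ρ / 3) 1)) with hε
  have hε0 : 0 < ε := lt_min (by linarith) (lt_min (by linarith) (lt_min (by linarith) one_pos))
  have hεθ : ε < θ := (min_le_left _ _).trans_lt (by linarith)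
  have hεδ : 2 * ε < δ := by
    have : ε ≤ δ / 3 := (min_le_right _ _).trans (min_le_left _ _)
    linarith
  have hερ : 2 * ε < ρ := by
    have : ε ≤ ρ / 3 := (min_le_right _ _).trans ((min_le_right _ _).trans (min_le_left _ _))
    linarith
  have hε1 : ε ≤ 1 := (min_le_right _ _).trans ((min_le_right _ _).trans (min_le_right _ _))
  obtain ⟨J, hJ⟩ := eventually_atTop.1 (h (R₀ + 1) ε hε0)
  refine ⟨J, fun j hj => ?_⟩
  obtain ⟨hA, hB⟩ := hJ j hj
  rcases isEmpty_or_nonempty (Fin (n j)) with hemp | hnon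
  · -- no particles: then no sites near the support either
    have hT0 : T = ∅ := Finset.eq_empty_of_forall_notMem fun s hs => by
      obtain ⟨i, -⟩ := hA s (hTmem s hs).1 (hTmem s hs).2
      exact isEmptyElim i
    simp [hT0, hη]
  -- the particle matched to each site of `T`
  choose! ι hι using fun s (hs : s ∈ T) => hA s (hTmem s hs).1 (hTmem s hs).2
  have hinj : ∀ s ∈ T, ∀ s' ∈ T, ι s = ι s' → s = s' := by
    intro s hs s' hs' hss'
    by_contra hne
    have h1 := hρsep s (hTmem s hs).1 s' (hTmem s' hs').1 hne
    have : dist s s' ≤ 2 * ε :=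
      calc dist s s' ≤ dist s (y j (ι s)) + dist (y j (ι s)) s' := dist_triangle _ _ _
        _ ≤ ε + ε := add_le_add (by rw [dist_comm]; exact hι s hs) (by rw [hss']; exact hι s' hs')
        _ = 2 * ε := by ring
    linarith
  -- unmatched particles do not see `f`
  have hzero : ∀ i ∈ (Finset.univ : Finset (Fin (n j))), i ∉ T.image ι → f (y j i) = 0 := by
    intro i _ hi
    by_contra hfi
    have hyR : ‖y j i‖ ≤ R₀ := mem_closedBall_zero_iff.1 (hR₀ (subset_tsupport _ hfi))
    obtain ⟨s, hsP, hds⟩ := hB i (by linarith)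
    have hsR : ‖s‖ ≤ R₀ + 1 := by
      have h1 := norm_sub_norm_le s (y j i)
      rw [← dist_eq_norm, dist_comm] at h1
      linarith
    have hsT : s ∈ T := by
      rw [← Finset.mem_coe, hT]; exact ⟨mem_closedBall_zero_iff.2 hsR, hsP⟩
    have his : i = ι s := by
      by_contra hne
      have h1 := hsep j i (ι s) hne
      have : dist (y j i) (y j (ι s)) ≤ 2 * ε :=
        calc dist (y j i) (y j (ι s)) ≤ dist (y j i) s + dist s (y j (ι s)) := dist_triangle _ _ _
          _ ≤ ε + ε := add_le_add hds (by rw [dist_comm]; exact hι s hsT)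
          _ = 2 * ε := by ring
      linarith
    exact hi (Finset.mem_image.2 ⟨s, hsT, his.symm⟩)
  have hsum : ∑ i, f (y j i) = ∑ s ∈ T, f (y j (ι s)) := by
    rw [← Finset.sum_subset (Finset.subset_univ (T.image ι)) hzero, Finset.sum_image hinj]
  rw [hsum, Real.dist_eq]
  have hterm : ∀ s ∈ T, |f (y j (ι s)) - f s| < η / (T.card + 1) := fun s hs => by
    have := hθf ((hι s hs).trans_lt hεθ)
    rwa [Real.dist_eq] at this
  calc |∑ s ∈ T, f (y j (ι s)) - ∑ s ∈ T, f s| = |∑ s ∈ T, (f (y j (ι s)) - f s)| := by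
        rw [Finset.sum_sub_distrib]
    _ ≤ ∑ s ∈ T, |f (y j (ι s)) - f s| := Finset.abs_sum_le_sum_abs _ _
    _ ≤ ∑ _s ∈ T, η / (T.card + 1) := Finset.sum_le_sum fun s hs => (hterm s hs).le
    _ = T.card * (η / (T.card + 1)) := by rw [Finset.sum_const, nsmul_eq_mul]
    _ = η * (T.card / (T.card + 1)) := by ring
    _ < η * 1 := by
        refine mul_lt_mul_of_pos_left ?_ hη
        rw [div_lt_one (by positivity)]
        linarith
    _ = η := mul_one η

/-- The same criterion in the exact shape of the convergence clause of `IsCrystallizing`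
(multiplicity `m ≡ 1`). [folklore] -/
theorem tendsto_sum_of_eventually_near' {n : ℕ → ℕ}
    (y : (j : ℕ) → Fin (n j) → EuclideanSpace ℝ (Fin d))
    {δ : ℝ} (hδ : 0 < δ) (hsep : ∀ j i i', i ≠ i' → δ ≤ dist (y j i) (y j i'))
    (h : ∀ R ε : ℝ, 0 < ε → ∀ᶠ j in atTop,
        (∀ s ∈ P.points, ‖s‖ ≤ R → ∃ i, dist (y j i) s ≤ ε) ∧
        (∀ i, ‖y j i‖ ≤ R → ∃ s ∈ P.points, dist (y j i) s ≤ ε))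
    {f : EuclideanSpace ℝ (Fin d) → ℝ} (hfc : Continuous f) (hf : HasCompactSupport f) :
    Tendsto (fun j => ∑ i, f (y j i)) atTop
      (𝓝 (∑' s : P.points, (((fun _ => 1 : EuclideanSpace ℝ (Fin d) → ℕ) s : ℕ) : ℝ) * f s)) := by
  simpa using P.tendsto_sum_of_eventually_near y hδ hsep h hfc hf

end PeriodicConfiguration

end Literature.MathematicalPhysics.StatisticalMechanics

end
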